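import Summits.BirchSwinnertonDyer.BirchSwinnertonDyer.Theorems.ErratumRoadFiveControlFromJSWMult
import Summits.BirchSwinnertonDyer.BirchSwinnertonDyer.Theorems.ErratumRoadFiveClassicalValueFromPrint
import Summits.BirchSwinnertonDyer.BirchSwinnertonDyer.Theorems.ErratumRoadFiveValueByNormContinuity
import Summits.BirchSwinnertonDyer.Rank1Residual.X11b.HalvesReceptacle
import HarnessLib

/-!
# Route `ErratumRoadFive` (K2): CTL₀ and H2 at a classical X11b datum WITHOUT the `¬ Ram` binder —
# the (T)-row ∕ (NW)-row twins («G3» of the cell's UB ledger) of the (¬ram) stub closures p456253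
# (`openInputNotRam_stub_charTorsionNotRam_of_thm331Mult`) and p462276
# (`openInputNotRam_stub_bdpValueNotRam_of_pNew`)

Cell `bsd-stepL` (run/shared/lean/pub/bsd-stepL/), seat `bsd-stepL-bdp` (prover g22, 2026-08-27).
`--supports stmt-BirchSwinnertonDyer-19702 --as helper` (crux `Rest3TorsionBranchAtFive`, the (T) rows:
a (ram) witness AND a non-zero `p`-torsion point in `E(ℚ_p)` — all split ∧ `p ∣ v_p(Δ)`).
THEOREMS ONLY (no definition, no named fact, no `sorry`).

WHY. The cell memo HOME/proof/PROOF-BDP.md §41.1 (the (γ−1)-separation of the Euler-system-side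
inclusion UB at a SPLIT `p ∥ N`; referee g45 PASS) consumes exactly two tree inputs at the height-one
prime `(T)`: CTL₀ (`X_ac^∅(E/K_∞)` is `Λ`-torsion with non-zero constant term of its characteristic
series) and H2 (the BDP value at `𝟙` is a unit times `((1 − a_p p⁻¹)·log_{ω_E} P)² ≠ 0`). Both are
in the tree on the (¬ram) rows (p456253 ∕ p462276, item 19282), where the binder `¬ Ram W p` is IDLE
(p456253's proof also leaves `5 ≤ p` idle). §41.4 ∕ §52.4 recorded the (T)-row ∕ (NW)-row twins as the
ledger entry «G3 (kernel-sized)»: the same two statements on rows that CARRY a (ram) witness (items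
19702 (T), 19703 (NW)). This file lands them: the binder-free forms (every classical X11b datum, any
odd multiplicative `p` for CTL₀; `5 ≤ p` for H2, which the JIMJ18 fact needs), and the (T)-row forms
with 19702's two extra binders `Ram W p`, `∃ P ∈ E(ℚ_p), p • P = 0 ∧ P ≠ 0` prepended (idle).

* `charTorsion_allRows_of_thm331Mult` — CTL₀ `∃ n, XAc.HasCharValuationAt (E/K) p κ 𝔭 ∅ γ n` at every
  classical X11b datum (no `¬ Ram`, no `5 ≤ p`), from JSW17 Thm. 3.3.1 at a multiplicative `p` +
  Kolyvagin: `p2ControlOnTree_odd_of_thm331Mult` then `Halves.exists_hasCharValuationAt_of_controlOnTreeAt`.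
* `bdpValue_allRows_of_pNew` — H2 at every classical X11b datum with `5 ≤ p` and every `R₀`-frame
  (no `¬ Ram`): `∃ u ∈ R₀ˣ, L(𝟙) = u·((1 − a_p p⁻¹)·log_{ω_E} P)²`; proof = p462276's, verbatim
  (multiplicity one; `𝔭 = 𝔭_{ι'}`; `ι = w₀ ∘ τ`; `continuousDisplayOnTree_of_pNew`; one-sided
  ♭-value rigidity; `R₀`-unit from the norm; rank-one symmetry).
* `rest3Torsion_charTorsion_of_thm331Mult`, `rest3Torsion_bdpValue_of_pNew` — the (T)-row twins
  (19702's binders `Ram W p`, `∃ P, p • P = 0 ∧ P ≠ 0` prepended, idle).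

HONEST FRAMING: CONDITIONAL theorems (named facts `thm331_anticyclotomicControl_mult` JSW17 3.3.1-mult,
`kolyvagin` Kolyvagin 1990 Thm. A, `thm210_thm211_bdpDisplay_pNew` Castella JIMJ18 2.10–2.11,
`rank_eq_analyticRank_of_analyticRank_le_one` GZK, `exists_isNewformOf` modularity — all PUBLISHED,
all already hypotheses of p456253 ∕ p462276); they discharge NO registered stub (19702's deciding stub is
`stub_t_imcDivSomeFrameB`, whose B12 reduction p518550 takes UB|T as a hypothesis; UB|T's memo proof is
what uses CTL₀ + H2 at `(T)`); nothing is booked (T7); BSD is proved for no class; X11b stays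
CONSTRUCTION-SHAPED. Not Theses-free only through its imports' imports? — NO: all four imports are
Theses-free kernel modules (p428223-line `ControlFromJSWMult`, bdp g12 `ClassicalValueFromPrint`,
bdp g11 `ValueByNormContinuity`, x11b3 `HalvesReceptacle`).

References: [JetchevSkinnerWan2017] Thm. 3.3.1 with §3.5 (3.5.c) (arXiv:1512.06894 pp. 11, 15);
[Kolyvagin1990] Thm. A; [Castella2018Exceptional] Thms. 2.10–2.11 (arXiv:1507.04260 pp. 13–14);
[Castella2018] Thm. 2.3, Thms. 3.1–3.2 (arXiv:1704.06608 pp. 5, 9) (shapes); [GrossZagier1986]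
Thm. I.6.3; cell memo PROOF-BDP §41.1, §41.4 (G3), §52.4, §53.
-/

set_option autoImplicit false
set_option linter.dupNamespace false

noncomputable section

open scoped Classical Topology

open Filter WeierstrassCurve NumberField IsDedekindDomain Field PowerSeries
open Literature.NumberTheory.EllipticCurves Literature.NumberTheory.EllipticCurves.ModularForms
  Literature.NumberTheory.EllipticCurves.Rank1Residual
  Literature.NumberTheory.EllipticCurves.JetchevSkinnerWan2017
  Literature.NumberTheory.EllipticCurves.Castella2018
  Literature.NumberTheory.EllipticCurves.Castella2018Exceptional
  Literature.NumberTheory.GaloisRepresentations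
open Summit.BirchSwinnertonDyer.Rank1Residual Summit.BirchSwinnertonDyer.Rank1Residual.X11b
  Summit.BirchSwinnertonDyer.Rank1Residual.X11b.AcSelmer
  Summit.BirchSwinnertonDyer.Rank1Residual.X11b.Halves

namespace Summit.BirchSwinnertonDyer.BirchSwinnertonDyer.Theorems.ControlValueAllRows

/-- **CTL₀ at every classical X11b datum, binder-free in `Ram` and `5 ≤ p`.** For `E` in class X11b at
`p` with `ρ̄_{E,p}` onto, `K` an odd-discriminant Heegner field with `p ∤ d_K·#𝓞_K^×`, a parametrisation
datum with `p ∤ c`, the Heegner point `P` of infinite order read through `ι`, anticyclotomic `(κ, γ)`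
and a degree-one prime `𝔭 ∋ p`: `∃ n, XAc.HasCharValuationAt (E/K) p κ 𝔭 ∅ γ n` (the anticyclotomic
Selmer dual strict at `𝔭` is `Λ`-torsion with a characteristic series of non-zero constant term).
Proof: the tree's control identity at EVERY X11b pair (`p2ControlOnTree_odd_of_thm331Mult`: JSW17
Thm. 3.3.1 at a multiplicative `p` + Kolyvagin at the non-torsion Heegner point), first conjunct
(`Halves.exists_hasCharValuationAt_of_controlOnTreeAt`). Twin of p456253 without its idle binders;
serves the (T) ∕ (NW) rows of the cell's UB ledger (G3). CONDITIONAL on the two named facts.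
[cite: JetchevSkinnerWan2017, Thm. 3.3.1 with §3.5 (3.5.c) (arXiv:1512.06894 pp. 11, 15)]
[cite: Kolyvagin1990, Thm. A] [cite: Castella2018, Thm. 2.3 (arXiv:1704.06608 p. 5) (shape)] -/
theorem charTorsion_allRows_of_thm331Mult (h : thm331_anticyclotomicControl_mult)
    (hKo : ∀ (N : ℕ) [NeZero N] (W : WeierstrassCurve ℚ) (K : Type) [Field K] [NumberField K],
      kolyvagin N W K) :
    ∀ (W : WeierstrassCurve ℚ) [W.IsElliptic] [W.IsGloballyMinimal] (p : ℕ) [Fact p.Prime]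
      (N : ℕ) [NeZero N] (K : Type) [Field K] [NumberField K]
      (Dt : ModularParametrizationData W N) (H : HeegnerDatum N (NumberField.discr K)) (ι : K →+* ℂ)
      (P : (W.baseChange K).toAffine.Point),
      ClassX11b W p → Surj W p → W.conductorNorm ℤ = N → IsImaginaryQuadratic K →
      Odd (NumberField.discr K) → ¬ (p : ℤ) ∣ NumberField.discr K → ¬ p ∣ Units.torsionOrder K →
      SatisfiesHeegnerHypothesis N K →
      (W.quadraticTwist (NumberField.discr K : ℚ)).entireLFunction 1 ≠ 0 →
      WeierstrassCurve.Affine.Point.map ι.toRatAlgHom P = heegnerPointComplex Dt H →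
      ¬ (p : ℤ) ∣ Dt.c → ¬ IsOfFinAddOrder P →
      ∀ (κ : ZpExtension K p), κ.IsAnticyclotomic →
        ∀ (γ : Field.absoluteGaloisGroup K) [Fact (κ.IsTopGenerator γ)]
          (𝔭 : HeightOneSpectrum (𝓞 K)), ((p : ℕ) : 𝓞 K) ∈ 𝔭.asIdeal →
          𝔭.asIdeal.ramificationIdx (𝓞 ℚ) = 1 → 𝔭.asIdeal.inertiaDeg (𝓞 ℚ) = 1 →
          ∃ n : ℕ, XAc.HasCharValuationAt (W.baseChange K) p κ 𝔭 ∅ γ n := by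
  intro W _ _ p _ N _ K _ _ Dt H ι P hX hsurj hN hK hodd hdisc htor hheeg hL1 hP hc hP0 κ hκ γ _ 𝔭 h𝔭
    he hf
  exact exists_hasCharValuationAt_of_controlOnTreeAt W p (embAt K p 𝔭 h𝔭 he hf) P κ 𝔭 γ
    (p2ControlOnTree_odd_of_thm331Mult W p h hKo N K Dt H ι P hX hsurj hN hK hodd hdisc htor hheeg
      hL1 hP hc hP0 κ hκ γ 𝔭 h𝔭 he hf)

/-- **H2 at every classical X11b datum with `5 ≤ p`, binder-free in `Ram`, at EVERY `R₀`-frame.** Same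
data as `charTorsion_allRows_of_thm331Mult` plus `5 ≤ p`, and a frame `(f, ι', Ω_K ≠ 0, Ω_p ∈ R₀ˣ, L)`
with `ι'` inducing `𝔭` and Castella's interpolation property `IsBDPLFunction ι' 𝔭 κ γ f Ω_K Ω_p L`:
`∃ u ∈ R₀ˣ, L(𝟙) = u·((1 − a_p(E) p⁻¹)·log_{ω_E} P)²`, the logarithm along `embAt K p 𝔭`. Proof =
p462276's verbatim (multiplicity one; `𝔭 = 𝔭_{ι'}` at the unique infinite place; `ι = w₀ ∘ τ` for the
involution `τ`; `continuousDisplayOnTree_of_pNew` from the JIMJ18 fact; one-sided ♭-value rigidity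
`intSeries_constantCoeff_eq_of_isBDPLFunctionInt_of_continuousValues`; the norm-one scalar is an
`R₀`-unit; rank-one symmetry `(log τ_* P)² = (log P)²`). Twin of p462276 without its idle `¬ Ram`
binder; serves the (T) ∕ (NW) rows of the cell's UB ledger (G3). CONDITIONAL on the three named facts.
[cite: Castella2018Exceptional, Thm. 2.10 and Thm. 2.11 with Prop. 2.7 (arXiv:1507.04260 pp. 13–14)]
[cite: BertoliniDarmonPrasanna2013, Thm. 5.13 and Prop. 5.10]
[cite: Castella2018, Thm. 3.2 with (3.2)–(3.3) (arXiv:1704.06608 p. 9) (shape)]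
[cite: GrossZagier1986, Thm. I.6.3] [cite: Kolyvagin1990, Thm. A] -/
theorem bdpValue_allRows_of_pNew (hB : thm210_thm211_bdpDisplay_pNew)
    (hGZK : rank_eq_analyticRank_of_analyticRank_le_one) (hnf : exists_isNewformOf) :
    ∀ (W : WeierstrassCurve ℚ) [W.IsElliptic] [W.IsGloballyMinimal] (p : ℕ) [Fact p.Prime]
      (N : ℕ) [NeZero N] (K : Type) [Field K] [NumberField K]
      (Dt : ModularParametrizationData W N) (H : HeegnerDatum N (NumberField.discr K)) (ι : K →+* ℂ)
      (P : (W.baseChange K).toAffine.Point),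
      ClassX11b W p → 5 ≤ p → Surj W p → W.conductorNorm ℤ = N → IsImaginaryQuadratic K →
      Odd (NumberField.discr K) → ¬ (p : ℤ) ∣ NumberField.discr K → ¬ p ∣ Units.torsionOrder K →
      SatisfiesHeegnerHypothesis N K →
      (W.quadraticTwist (NumberField.discr K : ℚ)).entireLFunction 1 ≠ 0 →
      WeierstrassCurve.Affine.Point.map ι.toRatAlgHom P = heegnerPointComplex Dt H →
      ¬ (p : ℤ) ∣ Dt.c → ¬ IsOfFinAddOrder P →
      ∀ (κ : ZpExtension K p), κ.IsAnticyclotomic →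
        ∀ (γ : Field.absoluteGaloisGroup K) [Fact (κ.IsTopGenerator γ)]
          (𝔭 : HeightOneSpectrum (𝓞 K)) (h𝔭 : ((p : ℕ) : 𝓞 K) ∈ 𝔭.asIdeal)
          (he : 𝔭.asIdeal.ramificationIdx (𝓞 ℚ) = 1) (hf : 𝔭.asIdeal.inertiaDeg (𝓞 ℚ) = 1),
          ∀ (f : CuspForm (CongruenceSubgroup.Gamma0 N) 2), IsNewformOf W f →
            ∀ (ι' : PadicAlgCl p ≃+* ℂ),
              (∀ (w : InfinitePlace K) (k : 𝓞 K),
                k ∈ 𝔭.asIdeal ↔ ‖ι'.symm (w.embedding (k : K))‖ < 1) →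
              ∀ (ΩK : ℂ) (Ωp : (unrIntegers p)ˣ) (L : UnrSeries p), ΩK ≠ 0 →
                IsBDPLFunction ι' 𝔭 κ γ f ΩK ((Ωp : unrIntegers p) : ℂ_[p]) L →
                  ∃ u : (unrIntegers p)ˣ, L.HasValueAt 0 (((u : unrIntegers p) : ℂ_[p]) *
                    (algebraMap ℚ_[p] ℂ_[p] (((1 : ℚ_[p]) - ((W.LFunction p : ℤ) : ℚ_[p]) *
                      (p : ℚ_[p])⁻¹) * logOmega W p (embAt K p 𝔭 h𝔭 he hf) P)) ^ 2) := by
  intro W _ _ p _ N _ K _ _ Dt H ιK P hX h5 hs hN hK hodd hpd hμ hHN hLt hP hc hPinf κ hκ γ hγ 𝔭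
    h𝔭 he hf f hfW ι' hι' ΩK Ωp L hΩK hL
  -- multiplicity one: the frame's newform is `f_{Dt}`
  obtain rfl : f = Dt.f := hfW.unique Dt.isNewformOf
  have hr : W.analyticRank = 1 := hX.1
  have hp2 : p ≠ 2 := hX.2.1
  -- one infinite place; `𝔭` is the prime of the embedding datum `ι'` there
  obtain ⟨w₀⟩ := (inferInstance : Nonempty (InfinitePlace K))
  obtain rfl : 𝔭 = primeOfEmbeddingDatum p ι' w₀.embedding :=
    eq_primeOfEmbeddingDatum_of_forall_mem_iff p ι' w₀.embedding (hι' w₀)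
  -- `rank_ℤ E(K) = 1` (Gross–Zagier–Kolyvagin at the classical Heegner field)
  have hrk : (W.baseChange K).mordellWeilRank = 1 :=
    mordellWeilRank_baseChange_eq_one_of_twist_ne_zero W hGZK hnf hr hK.1 hLt
  -- the datum's complex embedding is `w₀.embedding ∘ τ` for an involution `τ ∈ Gal(K/ℚ)`
  haveI : IsGalois ℚ K := by
    haveI : Algebra.IsQuadraticExtension ℚ K := ⟨hK.1⟩
    infer_instance
  obtain ⟨σ, hσ⟩ := ComplexEmbedding.exists_comp_symm_eq_of_comp_eq (k := ℚ) w₀.embedding ιK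
    (by ext x; simp)
  set τ : K →+* K := ((σ.symm : K ≃ₐ[ℚ] K) : K →+* K) with hτdef
  have hτ : ∀ x, τ (τ x) = x := by
    intro x
    have hcard : Nat.card (K ≃ₐ[ℚ] K) = 2 := by rw [IsGalois.card_aut_eq_finrank, hK.1]
    have hsq : σ.symm * σ.symm = 1 := by
      have h := pow_card_eq_one' (G := K ≃ₐ[ℚ] K) (x := σ.symm)
      rwa [hcard, pow_two] at h
    have := congrArg (fun g : K ≃ₐ[ℚ] K ↦ g x) hsq
    simpa [hτdef, AlgEquiv.mul_apply] using this
  -- the Galois conjugate `P' = τ_* P` is the Heegner point read through `w₀.embedding`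
  set P' := WeierstrassCurve.Affine.Point.map τ.toRatAlgHom P with hP'def
  have hP' : WeierstrassCurve.Affine.Point.map w₀.embedding.toRatAlgHom P' =
      heegnerPointComplex Dt H := by
    rw [hP'def, WeierstrassCurve.Affine.Point.map_map]
    have hcomp : w₀.embedding.toRatAlgHom.comp τ.toRatAlgHom = ιK.toRatAlgHom := by
      apply AlgHom.ext
      intro x
      have := RingHom.congr_fun hσ x
      simpa [hτdef] using this
    rw [hcomp]
    exact hP
  -- THE embedding at `𝔭` induces `𝔭`
  set e : K →+* ℚ_[p] := embAt K p (primeOfEmbeddingDatum p ι' w₀.embedding) h𝔭 he hf with hedef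
  have hemb : ∀ k : 𝓞 K,
      k ∈ (primeOfEmbeddingDatum p ι' w₀.embedding).asIdeal ↔ ‖e (k : K)‖ < 1 :=
    mem_asIdeal_iff_norm_embAt_lt_one _ h𝔭 he hf
  -- the display's continuity at `𝟙`, with non-zero limit, from the JIMJ18 fact (bdp g12)
  obtain ⟨ΩK₀, Ωp₀, u, hΩK₀, hΩp₀, hu, hc0, hcont⟩ := continuousDisplayOnTree_of_pNew hB N K Dt H ιK P
    hX h5 hs hN hK hodd hpd hμ hHN hLt hP hc hPinf κ hκ γ ι' w₀ P' hP' e hemb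
  -- one-sided ♭-value rigidity across periods: the constant term of `L` is the limit
  have hΩp : ((Ωp : unrIntegers p) : ℂ_[p]) ≠ 0 := by
    rw [Ne, ZeroMemClass.coe_eq_zero]
    exact Units.ne_zero Ωp
  have heq := intSeries_constantCoeff_eq_of_isBDPLFunctionInt_of_continuousValues hp2 hK hκ hγ.out
    hΩK₀ hΩK hΩp₀ hΩp hcont hc0 (R1.isBDPLFunctionInt_map hL)
  set X : ℚ_[p] := ((1 : ℚ_[p]) - ((W.LFunction p : ℤ) : ℚ_[p]) * (p : ℚ_[p])⁻¹) *
    logOmega W p e P' with hXdef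
  have hcoe : ((PowerSeries.constantCoeff L : unrIntegers p) : ℂ_[p]) =
      u * (algebraMap ℚ_[p] ℂ_[p] X) ^ 2 := by
    rw [← heq, ← coeff_zero_eq_constantCoeff_apply (PowerSeries.map (R1.unrToCpInt p) L),
      PowerSeries.coeff_map, coeff_zero_eq_constantCoeff_apply, R1.coe_unrToCpInt]
  -- the norm-one scalar is a unit of `R₀`
  have hX0 : algebraMap ℚ_[p] ℂ_[p] X ≠ 0 := by
    intro h0
    apply hc0
    rw [h0, zero_pow two_ne_zero, mul_zero]
  have hX0' : X ^ 2 ≠ 0 :=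
    pow_ne_zero 2 ((map_ne_zero_iff _ (algebraMap ℚ_[p] ℂ_[p]).injective).mp hX0)
  have hnorm : ‖((PowerSeries.constantCoeff L : unrIntegers p) : ℂ_[p])‖ =
      ‖algebraMap ℚ_[p] ℂ_[p] (X ^ 2)‖ := by
    rw [hcoe, norm_mul, hu, one_mul, map_pow]
  obtain ⟨u₀, hu₀⟩ := exists_unit_unrIntegers_mul_eq_of_norm_eq (PowerSeries.constantCoeff L) hX0' hnorm
  -- the value shape at `τ_* P`, then at `P` by rank-one symmetry
  have hval' : R1.BDPValueAtOneOnTreeAt W p e P' L (W.LFunction p) := by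
    refine ⟨u₀, ?_⟩
    have h0 := UnrSeries.hasValueAt_zero L
    rw [← hu₀, map_pow] at h0
    exact h0
  exact (R1.bdpValueAtOneOnTreeAt_map_iff_of_rank_one W p e τ hτ hrk hPinf L (W.LFunction p)).mp hval'

/-- **(T)-row twin of CTL₀** (item 19702 `Rest3TorsionBranchAtFive`: the rows with a (ram) witness
and a non-zero `p`-torsion point of `E(ℚ_p)`): the registered (T) binders `Ram W p`,
`∃ P ∈ E(ℚ_p), p • P = 0 ∧ P ≠ 0` prepended (idle) to `charTorsion_allRows_of_thm331Mult`. This is the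
G3 entry of the UB ledger (PROOF-BDP §41.4 ∕ §52.4) for CTL₀ on the (T) rows, by name. CONDITIONAL on
the two named facts; closes nothing. [cite: JetchevSkinnerWan2017, Thm. 3.3.1 (arXiv:1512.06894 p. 11)]
[cite: Kolyvagin1990, Thm. A] -/
theorem rest3Torsion_charTorsion_of_thm331Mult (h : thm331_anticyclotomicControl_mult)
    (hKo : ∀ (N : ℕ) [NeZero N] (W : WeierstrassCurve ℚ) (K : Type) [Field K] [NumberField K],
      kolyvagin N W K) :
    ∀ (W : WeierstrassCurve ℚ) [W.IsElliptic] [W.IsGloballyMinimal] (p : ℕ) [Fact p.Prime],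
      Literature.NumberTheory.EllipticCurves.Rank1Residual.Ram W p →
      (∃ Q : (W.baseChange ℚ_[p]).toAffine.Point, p • Q = 0 ∧ Q ≠ 0) →
      ∀ (N : ℕ) [NeZero N] (K : Type) [Field K] [NumberField K]
      (Dt : ModularParametrizationData W N) (H : HeegnerDatum N (NumberField.discr K)) (ι : K →+* ℂ)
      (P : (W.baseChange K).toAffine.Point),
      ClassX11b W p → Surj W p → W.conductorNorm ℤ = N → IsImaginaryQuadratic K →
      Odd (NumberField.discr K) → ¬ (p : ℤ) ∣ NumberField.discr K → ¬ p ∣ Units.torsionOrder K →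
      SatisfiesHeegnerHypothesis N K →
      (W.quadraticTwist (NumberField.discr K : ℚ)).entireLFunction 1 ≠ 0 →
      WeierstrassCurve.Affine.Point.map ι.toRatAlgHom P = heegnerPointComplex Dt H →
      ¬ (p : ℤ) ∣ Dt.c → ¬ IsOfFinAddOrder P →
      ∀ (κ : ZpExtension K p), κ.IsAnticyclotomic →
        ∀ (γ : Field.absoluteGaloisGroup K) [Fact (κ.IsTopGenerator γ)]
          (𝔭 : HeightOneSpectrum (𝓞 K)), ((p : ℕ) : 𝓞 K) ∈ 𝔭.asIdeal →
          𝔭.asIdeal.ramificationIdx (𝓞 ℚ) = 1 → 𝔭.asIdeal.inertiaDeg (𝓞 ℚ) = 1 →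
          ∃ n : ℕ, XAc.HasCharValuationAt (W.baseChange K) p κ 𝔭 ∅ γ n := by
  intro W _ _ p _ _hram _hT N _ K _ _ Dt H ι P hX hsurj hN hK hodd hdisc htor hheeg hL1 hP hc hP0 κ hκ
    γ _ 𝔭 h𝔭 he hf
  exact charTorsion_allRows_of_thm331Mult h hKo W p N K Dt H ι P hX hsurj hN hK hodd hdisc htor hheeg
    hL1 hP hc hP0 κ hκ γ 𝔭 h𝔭 he hf

/-- **(T)-row twin of H2** (item 19702): the registered (T) binders `Ram W p`,
`∃ P ∈ E(ℚ_p), p • P = 0 ∧ P ≠ 0` prepended (idle) to `bdpValue_allRows_of_pNew`. This is the G3 entry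
of the UB ledger (PROOF-BDP §41.4 ∕ §52.4) for H2 on the (T) rows, by name: at a split `p` the value
`u·((1 − p⁻¹)·log_{ω_E} P)²` is non-zero (no exceptional zero of the SQUARE BDP function at `𝟙`,
§41.1). CONDITIONAL on the three named facts; closes nothing.
[cite: Castella2018Exceptional, Thm. 2.10 and Thm. 2.11 (arXiv:1507.04260 pp. 13–14)]
[cite: GrossZagier1986, Thm. I.6.3] [cite: Kolyvagin1990, Thm. A] -/
theorem rest3Torsion_bdpValue_of_pNew (hB : thm210_thm211_bdpDisplay_pNew)
    (hGZK : rank_eq_analyticRank_of_analyticRank_le_one) (hnf : exists_isNewformOf) :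
    ∀ (W : WeierstrassCurve ℚ) [W.IsElliptic] [W.IsGloballyMinimal] (p : ℕ) [Fact p.Prime],
      Literature.NumberTheory.EllipticCurves.Rank1Residual.Ram W p →
      (∃ Q : (W.baseChange ℚ_[p]).toAffine.Point, p • Q = 0 ∧ Q ≠ 0) →
      ∀ (N : ℕ) [NeZero N] (K : Type) [Field K] [NumberField K]
      (Dt : ModularParametrizationData W N) (H : HeegnerDatum N (NumberField.discr K)) (ι : K →+* ℂ)
      (P : (W.baseChange K).toAffine.Point),
      ClassX11b W p → 5 ≤ p → Surj W p → W.conductorNorm ℤ = N → IsImaginaryQuadratic K →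
      Odd (NumberField.discr K) → ¬ (p : ℤ) ∣ NumberField.discr K → ¬ p ∣ Units.torsionOrder K →
      SatisfiesHeegnerHypothesis N K →
      (W.quadraticTwist (NumberField.discr K : ℚ)).entireLFunction 1 ≠ 0 →
      WeierstrassCurve.Affine.Point.map ι.toRatAlgHom P = heegnerPointComplex Dt H →
      ¬ (p : ℤ) ∣ Dt.c → ¬ IsOfFinAddOrder P →
      ∀ (κ : ZpExtension K p), κ.IsAnticyclotomic →
        ∀ (γ : Field.absoluteGaloisGroup K) [Fact (κ.IsTopGenerator γ)]
          (𝔭 : HeightOneSpectrum (𝓞 K)) (h𝔭 : ((p : ℕ) : 𝓞 K) ∈ 𝔭.asIdeal)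
          (he : 𝔭.asIdeal.ramificationIdx (𝓞 ℚ) = 1) (hf : 𝔭.asIdeal.inertiaDeg (𝓞 ℚ) = 1),
          ∀ (f : CuspForm (CongruenceSubgroup.Gamma0 N) 2), IsNewformOf W f →
            ∀ (ι' : PadicAlgCl p ≃+* ℂ),
              (∀ (w : InfinitePlace K) (k : 𝓞 K),
                k ∈ 𝔭.asIdeal ↔ ‖ι'.symm (w.embedding (k : K))‖ < 1) →
              ∀ (ΩK : ℂ) (Ωp : (unrIntegers p)ˣ) (L : UnrSeries p), ΩK ≠ 0 →
                IsBDPLFunction ι' 𝔭 κ γ f ΩK ((Ωp : unrIntegers p) : ℂ_[p]) L →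
                  ∃ u : (unrIntegers p)ˣ, L.HasValueAt 0 (((u : unrIntegers p) : ℂ_[p]) *
                    (algebraMap ℚ_[p] ℂ_[p] (((1 : ℚ_[p]) - ((W.LFunction p : ℤ) : ℚ_[p]) *
                      (p : ℚ_[p])⁻¹) * logOmega W p (embAt K p 𝔭 h𝔭 he hf) P)) ^ 2) := by
  intro W _ _ p _ _hram _hT N _ K _ _ Dt H ιK P hX h5 hs hN hK hodd hpd hμ hHN hLt hP hc hPinf κ hκ γ
    hγ 𝔭 h𝔭 he hf f hfW ι' hι' ΩK Ωp L hΩK hL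
  exact bdpValue_allRows_of_pNew hB hGZK hnf W p N K Dt H ιK P hX h5 hs hN hK hodd hpd hμ hHN hLt hP
    hc hPinf κ hκ γ 𝔭 h𝔭 he hf f hfW ι' hι' ΩK Ωp L hΩK hL

end Summit.BirchSwinnertonDyer.BirchSwinnertonDyer.Theorems.ControlValueAllRows

end
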